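import Literature.NumberTheory.EllipticCurves.BinaryQuarticAdditive
import Literature.NumberTheory.EllipticCurves.BinaryQuarticInvariantMapSubmersiveProofs
import Mathlib.Algebra.MvPolynomial.PDeriv
import HarnessLib

/-!
# The orbit chart of a binary quartic form: the polynomial maps behind the `p`-adic
# change-of-measure formula of Bhargava–Shankar (Props. 3.11–3.12: the constant `|1/27|_p`)

Topic `Literature/NumberTheory/EllipticCurves`; continues `BinaryQuarticForms.lean`
(`subst`, `I`, `J`), `BinaryQuarticLocalSolubility.lean` (`coeffs`), `BinaryQuarticAdditive.lean`
(the module `V_R`) and `BinaryQuarticInvariantMapSubmersiveProofs.lean` (`∂I`, `∂J` independent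
off `Δ = 0`). Definitions and algebraic identities only (no named facts); the measure theory is in
the companion `Proofs` files.

Bhargava–Shankar (Ann. of Math. 181 (2015); Props. 3.11–3.12 of the published version, "the
principle of permanence of identities" applied to Prop. 2.8 = Prop. 2.7 of `arXiv:1006.1002v2`)
compute `p`-adic volumes of `PGL₂(ℤ_p)`-invariant sets of forms through the map
`(g, s) ↦ g · s`, `g` in the group, `s` in a two-parameter family transverse to the orbits, whose
Jacobian is the constant `2/27` (for the basis `e, h, f` of `𝔰𝔩₂`; `1/27` for `ℤ_p`-bases of
`𝔤𝔩₂/𝔷`). This file sets up that map at an arbitrary form `f` over a commutative ring `R`, as a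
square *polynomial* system in five variables `(β, γ, δ, u, v)` (indices `0, …, 4`), for a
transverse direction `w ∈ V_R`:

* `orbitChart f w` — the system `Ψ(β,γ,δ,u,v) = coefficients of ((1+u)·f + v·w)((x,y)·M)`,
  `M = (1 β; γ δ+βγ)` (`det M = δ`; near `(0,0,1,0,0)` these matrices, times the scalars, fill the
  congruence subgroups of `GL₂(ℤ_p)`), evaluated pointwise by `eval_orbitChart`;
* `invChart f w` — the system `Φ(β,γ,δ,u,v) = (β, γ, δ, δ⁴ I(s), δ⁶ J(s))`, `s = (1+u)f + v w`, i.e.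
  the invariants of `Ψ` (`I(Ψ) = δ⁴ I(s)`, `J(Ψ) = δ⁶ J(s)`: `invariants_orbitChart`), with the
  group coordinates carried along;
* their Jacobian matrices at the base point `chartCenter = (0,0,1,0,0)` (`jacobian_orbitChart`,
  `jacobian_invChart`): the columns `ℒ_β f = (b,2c,3d,4e,0)`, `ℒ_γ f = (0,4a,3b,2c,d)`,
  `ℒ_δ f = (0,b,2c,3d,4e)`, `f`, `w` for `Ψ`, and a block-triangular matrix with corner
  `(2I  ∂I(w); 3J  ∂J(w))` for `Φ`;
* **the determinant identities** `27 · det J_Ψ = m(f,w)` (`det_jacOrbit`) and `det J_Φ = m(f,w)`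
  (`det_jacInv`), where `m(f,w) = 2 I(f) ∂J_f(w) − 3 J(f) ∂I_f(w)` (`sliceJac`) — the algebraic
  content of the constant `|1/27|_p`: `|det J_Ψ|_p = |1/27|_p · |det J_Φ|_p`;
* the unimodular factorisation `J_Φ = J'_Φ · S` (`jacInv_eq_mul_shear`) separating the group block
  from the invariant block `(2I ∂I(w); 3J ∂J(w))` (`invBlock`);
* **nondegeneracy** (`exists_sliceJac_unitForm_ne_zero`): over a field with `2, 3 ≠ 0`, if
  `Δ(f) ≠ 0` then `m(f, e_κ) ≠ 0` for some coordinate form `e_κ` (Euler's identities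
  `∂I_f(f) = 2I`, `∂J_f(f) = 3J` and the independence of `∂I`, `∂J` off `Δ = 0`).

## References

* M. Bhargava, A. Shankar, Ann. of Math. (2) 181 (2015) 191–242, Props. 2.8, 3.11–3.12 of the
  published version (Prop. 2.7 and the proof of Prop. 5.12 of `arXiv:1006.1002v2`: "Proposition 2.7
  and the principle of permanence of identities imply … `|2/27|_p Vol(PGL₂(ℤ_p))`").
  [cite: BhargavaShankarAnnals2015, Prop. 2.7 and Prop. 5.12 proof (arXiv:1006.1002v2 numbering)]
-/

noncomputable section

open MvPolynomial Matrix

namespace Literature.NumberTheory.EllipticCurves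

namespace BinaryQuartic

variable {R : Type*} [CommRing R]

/-! ## Coordinate forms, gradients of `I` and `J`, the slice Jacobian `m(f, w)` -/

/-- The coordinate forms `e_κ`: `x⁴, x³y, x²y², xy³, y⁴`. [folklore] -/
def unitForm (κ : Fin 5) : BinaryQuartic R :=
  ⟨(Pi.single κ 1 : Fin 5 → R) 0, (Pi.single κ 1 : Fin 5 → R) 1, (Pi.single κ 1 : Fin 5 → R) 2,
    (Pi.single κ 1 : Fin 5 → R) 3, (Pi.single κ 1 : Fin 5 → R) 4⟩

/-- The coefficients of `e_κ` form the `κ`-th standard basis vector. [folklore] -/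
@[simp] theorem coeffs_unitForm (κ : Fin 5) : (unitForm κ : BinaryQuartic R).coeffs = Pi.single κ 1 := by
  funext i
  fin_cases i <;> rfl

/-- The gradient of `I = 12ae − 3bd + c²`: `∂I = (12e, −3d, 2c, −3b, 12a)`. [folklore] -/
def gradI (f : BinaryQuartic R) : Fin 5 → R :=
  ![12 * f.e, -3 * f.d, 2 * f.c, -3 * f.b, 12 * f.a]

/-- The gradient of `J`: `∂J = (72ce − 27d², 9cd − 54be, 72ae + 9bd − 6c², 9bc − 54ad, 72ac − 27b²)`.
[folklore] -/
def gradJ (f : BinaryQuartic R) : Fin 5 → R :=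
  ![72 * f.c * f.e - 27 * f.d ^ 2, 9 * f.c * f.d - 54 * f.b * f.e,
    72 * f.a * f.e + 9 * f.b * f.d - 6 * f.c ^ 2, 9 * f.b * f.c - 54 * f.a * f.d, 72 * f.a * f.c - 27 * f.b ^ 2]

/-- The derivative of `I` at `f` in the direction `w`: `∂I_f(w) = Σ ∂_κ I(f) w_κ`. [folklore] -/
def dIAt (f w : BinaryQuartic R) : R := ∑ i, f.gradI i * w.coeffs i

/-- The derivative of `J` at `f` in the direction `w`. [folklore] -/
def dJAt (f w : BinaryQuartic R) : R := ∑ i, f.gradJ i * w.coeffs i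

/-- **The slice Jacobian `m(f, w) = 2 I(f) ∂J_f(w) − 3 J(f) ∂I_f(w)`** — the determinant of the
invariant map restricted to the two-parameter family `(u, v) ↦ (1+u) f + v w` at `(0, 0)`
(`det_jacInv`). [folklore] -/
def sliceJac (f w : BinaryQuartic R) : R := 2 * f.I * f.dJAt w - 3 * f.J * f.dIAt w

/-- `∂I_f(w)` expanded. [folklore] -/
theorem dIAt_eq (f w : BinaryQuartic R) :
    f.dIAt w = 12 * f.e * w.a - 3 * f.d * w.b + 2 * f.c * w.c - 3 * f.b * w.d + 12 * f.a * w.e := by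
  simp [dIAt, gradI, coeffs, Fin.sum_univ_five]; ring

/-- `∂J_f(w)` expanded. [folklore] -/
theorem dJAt_eq (f w : BinaryQuartic R) :
    f.dJAt w = (72 * f.c * f.e - 27 * f.d ^ 2) * w.a + (9 * f.c * f.d - 54 * f.b * f.e) * w.b +
      (72 * f.a * f.e + 9 * f.b * f.d - 6 * f.c ^ 2) * w.c + (9 * f.b * f.c - 54 * f.a * f.d) * w.d +
      (72 * f.a * f.c - 27 * f.b ^ 2) * w.e := by
  simp [dJAt, gradJ, coeffs, Fin.sum_univ_five]

/-- **Euler's identity for `I`** (homogeneous of degree `2`): `∂I_f(f) = 2 I(f)`. [folklore] -/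
theorem dIAt_self (f : BinaryQuartic R) : f.dIAt f = 2 * f.I := by
  rw [dIAt_eq]; simp only [I]; ring

/-- **Euler's identity for `J`** (homogeneous of degree `3`): `∂J_f(f) = 3 J(f)`. [folklore] -/
theorem dJAt_self (f : BinaryQuartic R) : f.dJAt f = 3 * f.J := by
  rw [dJAt_eq]; simp only [J]; ring

/-- First-order expansion of `I` along a line: `I(f + t w) = I(f) + t ∂I_f(w) + t² I(w)`. [folklore] -/
theorem I_add_smul_dIAt (f w : BinaryQuartic R) (t : R) :
    (f + t • w).I = f.I + t * f.dIAt w + t ^ 2 * w.I := by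
  rw [dIAt_eq]; simp only [I, add_a, add_b, add_c, add_d, add_e, smul_a, smul_b, smul_c, smul_d, smul_e]; ring

/-- Second-order expansion of `J` along a line: `J(f + t w) = J(f) + t ∂J_f(w) + t² Q` with an
explicit (polarised) remainder `Q`. [folklore] -/
theorem J_add_smul_exists (f w : BinaryQuartic R) (t : R) :
    ∃ Q : R, (f + t • w).J = f.J + t * f.dJAt w + t ^ 2 * Q := by
  refine ⟨(72 * f.a * w.c * w.e - 27 * f.a * w.d ^ 2 - 54 * f.b * w.b * w.e + 9 * f.b * w.c * w.d
      + 72 * f.c * w.a * w.e + 9 * f.c * w.b * w.d - 6 * f.c * w.c ^ 2 - 54 * f.d * w.a * w.d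
      + 9 * f.d * w.b * w.c + 72 * f.e * w.a * w.c - 27 * f.e * w.b ^ 2) + t * w.J, ?_⟩
  rw [dJAt_eq]
  simp only [J, add_a, add_b, add_c, add_d, add_e, smul_a, smul_b, smul_c, smul_d, smul_e]
  ring

/-- `∂I` is linear in the base form. [folklore] -/
theorem dIAt_smul_left (c : R) (f w : BinaryQuartic R) : (c • f).dIAt w = c * f.dIAt w := by
  rw [dIAt_eq, dIAt_eq]; simp only [smul_a, smul_b, smul_c, smul_d, smul_e]; ring

/-- `∂J` is quadratic in the base form. [folklore] -/
theorem dJAt_smul_left (c : R) (f w : BinaryQuartic R) : (c • f).dJAt w = c ^ 2 * f.dJAt w := by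
  rw [dJAt_eq, dJAt_eq]; simp only [smul_a, smul_b, smul_c, smul_d, smul_e]; ring

/-- `∂I` is linear in the direction. [folklore] -/
theorem dIAt_smul_right (c : R) (f w : BinaryQuartic R) : f.dIAt (c • w) = c * f.dIAt w := by
  rw [dIAt_eq, dIAt_eq]; simp only [smul_a, smul_b, smul_c, smul_d, smul_e]; ring

/-- `∂J` is linear in the direction. [folklore] -/
theorem dJAt_smul_right (c : R) (f w : BinaryQuartic R) : f.dJAt (c • w) = c * f.dJAt w := by
  rw [dJAt_eq, dJAt_eq]; simp only [smul_a, smul_b, smul_c, smul_d, smul_e]; ring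

/-- `∂I` commutes with change of ring. [folklore] -/
theorem dIAt_map {S : Type*} [CommRing S] (φ : R →+* S) (f w : BinaryQuartic R) :
    (f.map φ).dIAt (w.map φ) = φ (f.dIAt w) := by
  simp only [dIAt_eq, map_a, map_b, map_c, map_d, map_e, map_sub, map_mul, map_add, map_ofNat]

/-- `∂J` commutes with change of ring. [folklore] -/
theorem dJAt_map {S : Type*} [CommRing S] (φ : R →+* S) (f w : BinaryQuartic R) :
    (f.map φ).dJAt (w.map φ) = φ (f.dJAt w) := by
  simp only [dJAt_eq, map_a, map_b, map_c, map_d, map_e, map_sub, map_mul, map_add, map_pow, map_ofNat]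

/-- `∂I`, `∂J` and `m` commute with change of ring. [folklore] -/
theorem sliceJac_map {S : Type*} [CommRing S] (φ : R →+* S) (f w : BinaryQuartic R) :
    (f.map φ).sliceJac (w.map φ) = φ (f.sliceJac w) := by
  simp only [sliceJac, dIAt_eq, dJAt_eq, I_map, J_map, map_a, map_b, map_c, map_d, map_e, map_sub,
    map_mul, map_add, map_pow, map_ofNat]

/-! ## The two polynomial systems -/

/-- The base point `(β, γ, δ, u, v) = (0, 0, 1, 0, 0)` of the chart (the identity matrix and the
form `f` itself). [folklore] -/
def chartCenter : Fin 5 → R := ![0, 0, 1, 0, 0]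

/-- The matrix `M(β, γ, δ) = (1 β; γ δ+βγ)` of the chart, with polynomial entries; `det M = δ`.
[folklore] -/
def chartMatrix : Matrix (Fin 2) (Fin 2) (MvPolynomial (Fin 5) R) :=
  !![1, X 0; X 1, X 2 + X 0 * X 1]

/-- `det M = δ`. [folklore] -/
theorem det_chartMatrix : (chartMatrix (R := R)).det = X 2 := by
  simp [chartMatrix, Matrix.det_fin_two]

/-- The generic slice form `s = (1 + u) f + v w` with polynomial coefficients. [folklore] -/
def sliceForm (f w : BinaryQuartic R) : BinaryQuartic (MvPolynomial (Fin 5) R) :=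
  (1 + X 3 : MvPolynomial (Fin 5) R) • f.map (C : R →+* MvPolynomial (Fin 5) R) +
    (X 4 : MvPolynomial (Fin 5) R) • w.map (C : R →+* MvPolynomial (Fin 5) R)

/-- **The orbit chart** `Ψ_{f,w}(β,γ,δ,u,v) = ((1+u) f + v w)((x,y)·M(β,γ,δ))` as a square
polynomial system (its values are coefficient vectors of forms). [cite: BhargavaShankarAnnals2015, Props. 2.7–2.8 (the map (g, s) ↦ g·s; arXiv:1006.1002v2 numbering)] -/
def orbitChart (f w : BinaryQuartic R) : Fin 5 → MvPolynomial (Fin 5) R :=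
  ((sliceForm f w).subst chartMatrix).coeffs

/-- **The invariant chart** `Φ_{f,w}(β,γ,δ,u,v) = (β, γ, δ, δ⁴ I(s), δ⁶ J(s))`, `s = (1+u)f + vw`:
the invariants of `Ψ_{f,w}` with the group coordinates carried along. [folklore] -/
def invChart (f w : BinaryQuartic R) : Fin 5 → MvPolynomial (Fin 5) R :=
  ![X 0, X 1, X 2, X 2 ^ 4 * (sliceForm f w).I, X 2 ^ 6 * (sliceForm f w).J]

/-- The slice form evaluated at a point `x`: `(1 + x₃) f + x₄ w`. [folklore] -/
theorem map_eval_sliceForm (f w : BinaryQuartic R) (x : Fin 5 → R) :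
    (sliceForm f w).map (MvPolynomial.eval x) = (1 + x 3) • f + x 4 • w := by
  apply BinaryQuartic.ext <;> simp [sliceForm, BinaryQuartic.map]

/-- The chart matrix evaluated at `x`. [folklore] -/
theorem chartMatrix_map_eval (x : Fin 5 → R) :
    (chartMatrix (R := R)).map (MvPolynomial.eval x) = !![1, x 0; x 1, x 2 + x 0 * x 1] := by
  ext i j; fin_cases i <;> fin_cases j <;> simp [chartMatrix]

/-- **Pointwise values of the orbit chart**: `Ψ(x) = coefficients of ((1+x₃)f + x₄w)((x,y)·M(x))`.
[folklore] -/
theorem eval_orbitChart (f w : BinaryQuartic R) (x : Fin 5 → R) :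
    (fun i ↦ MvPolynomial.eval x (orbitChart f w i)) =
      (((1 + x 3) • f + x 4 • w).subst !![1, x 0; x 1, x 2 + x 0 * x 1]).coeffs := by
  funext i
  have h : ((sliceForm f w).subst chartMatrix).map (MvPolynomial.eval x) =
      ((1 + x 3) • f + x 4 • w).subst !![1, x 0; x 1, x 2 + x 0 * x 1] := by
    rw [map_subst, map_eval_sliceForm, chartMatrix_map_eval]
  have := congrArg (fun g ↦ g.coeffs i) h
  simpa [orbitChart, coeffs_map] using this

/-- **Pointwise values of the invariant chart**: `Φ(x) = (x₀, x₁, x₂, x₂⁴ I(s_x), x₂⁶ J(s_x))`,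
`s_x = (1+x₃) f + x₄ w`. [folklore] -/
theorem eval_invChart (f w : BinaryQuartic R) (x : Fin 5 → R) :
    (fun i ↦ MvPolynomial.eval x (invChart f w i)) =
      ![x 0, x 1, x 2, x 2 ^ 4 * ((1 + x 3) • f + x 4 • w).I, x 2 ^ 6 * ((1 + x 3) • f + x 4 • w).J] := by
  have hI : MvPolynomial.eval x (sliceForm f w).I = ((1 + x 3) • f + x 4 • w).I := by
    rw [← I_map, map_eval_sliceForm]
  have hJ : MvPolynomial.eval x (sliceForm f w).J = ((1 + x 3) • f + x 4 • w).J := by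
    rw [← J_map, map_eval_sliceForm]
  funext i
  fin_cases i <;> simp [invChart, hI, hJ]

/-- At the base point the orbit chart is `f` itself. [folklore] -/
theorem eval_orbitChart_center (f w : BinaryQuartic R) :
    (fun i ↦ MvPolynomial.eval chartCenter (orbitChart f w i)) = f.coeffs := by
  rw [eval_orbitChart]
  have h1 : (!![1, (chartCenter : Fin 5 → R) 0; chartCenter 1, chartCenter 2 + chartCenter 0 * chartCenter 1] :
      Matrix (Fin 2) (Fin 2) R) = 1 := by
    ext i j; fin_cases i <;> fin_cases j <;> simp [chartCenter]
  rw [h1, subst_one]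
  simp [chartCenter]

/-- At the base point the invariant chart is `(0, 0, 1, I(f), J(f))`. [folklore] -/
theorem eval_invChart_center (f w : BinaryQuartic R) :
    (fun i ↦ MvPolynomial.eval chartCenter (invChart f w i)) = ![0, 0, 1, f.I, f.J] := by
  rw [eval_invChart]
  simp [chartCenter]

/-- **The invariants along the orbit chart**: `I(Ψ(x)) = x₂⁴ I(s_x)` and `J(Ψ(x)) = x₂⁶ J(s_x)` —
the last two components of `Φ(x)`. [folklore] -/
theorem invariants_orbitChart (f w : BinaryQuartic R) (x : Fin 5 → R) :
    (((1 + x 3) • f + x 4 • w).subst !![1, x 0; x 1, x 2 + x 0 * x 1]).I = x 2 ^ 4 * ((1 + x 3) • f + x 4 • w).I ∧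
    (((1 + x 3) • f + x 4 • w).subst !![1, x 0; x 1, x 2 + x 0 * x 1]).J = x 2 ^ 6 * ((1 + x 3) • f + x 4 • w).J := by
  have hdet : (!![1, x 0; x 1, x 2 + x 0 * x 1] : Matrix (Fin 2) (Fin 2) R).det = x 2 := by
    simp [Matrix.det_fin_two]
  rw [I_subst, J_subst, hdet]
  exact ⟨rfl, rfl⟩

/-! ## The Jacobian matrices at the base point -/

/-- The Jacobian matrix of the orbit chart at the base point: columns `ℒ_β f = (b, 2c, 3d, 4e, 0)`,
`ℒ_γ f = (0, 4a, 3b, 2c, d)`, `ℒ_δ f = (0, b, 2c, 3d, 4e)` (the orbit directions), `f` (scaling)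
and `w`. [folklore] -/
def jacOrbit (f w : BinaryQuartic R) : Matrix (Fin 5) (Fin 5) R :=
  !![f.b, 0, 0, f.a, w.a;
     2 * f.c, 4 * f.a, f.b, f.b, w.b;
     3 * f.d, 3 * f.b, 2 * f.c, f.c, w.c;
     4 * f.e, 2 * f.c, 3 * f.d, f.d, w.d;
     0, f.d, 4 * f.e, f.e, w.e]

/-- The Jacobian matrix of the invariant chart at the base point: identity on the group block,
and `∂(δ⁴I, δ⁶J)/∂(δ, u, v) = (4I 2I ∂I(w); 6J 3J ∂J(w))`. [folklore] -/
def jacInv (f w : BinaryQuartic R) : Matrix (Fin 5) (Fin 5) R :=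
  !![1, 0, 0, 0, 0;
     0, 1, 0, 0, 0;
     0, 0, 1, 0, 0;
     0, 0, 4 * f.I, 2 * f.I, f.dIAt w;
     0, 0, 6 * f.J, 3 * f.J, f.dJAt w]

/-- The invariant block `(2I ∂I(w); 3J ∂J(w))` of `jacInv` — the Jacobian of
`(u, v) ↦ (I, J)((1+u)f + vw)` at `(0,0)`. [folklore] -/
def invBlock (f w : BinaryQuartic R) : Matrix (Fin 2) (Fin 2) R :=
  !![2 * f.I, f.dIAt w; 3 * f.J, f.dJAt w]

/-- `det (2I ∂I(w); 3J ∂J(w)) = m(f, w)`. [folklore] -/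
theorem det_invBlock (f w : BinaryQuartic R) : (invBlock f w).det = f.sliceJac w := by
  simp [invBlock, Matrix.det_fin_two, sliceJac]; ring

/-- The group block with the shear removed: `J'_Φ = diag(1, 1, 1) ⊕ (2I ∂I(w); 3J ∂J(w))`. [folklore] -/
def jacInv' (f w : BinaryQuartic R) : Matrix (Fin 5) (Fin 5) R :=
  !![1, 0, 0, 0, 0;
     0, 1, 0, 0, 0;
     0, 0, 1, 0, 0;
     0, 0, 0, 2 * f.I, f.dIAt w;
     0, 0, 0, 3 * f.J, f.dJAt w]

/-- The unimodular shear `u ↦ u + 2δ` (integer entries, integer inverse). [folklore] -/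
def shear : Matrix (Fin 5) (Fin 5) R :=
  !![1, 0, 0, 0, 0;
     0, 1, 0, 0, 0;
     0, 0, 1, 0, 0;
     0, 0, 2, 1, 0;
     0, 0, 0, 0, 1]

/-- The inverse shear. [folklore] -/
def shearInv : Matrix (Fin 5) (Fin 5) R :=
  !![1, 0, 0, 0, 0;
     0, 1, 0, 0, 0;
     0, 0, 1, 0, 0;
     0, 0, -2, 1, 0;
     0, 0, 0, 0, 1]

/-- `shear · shearInv = 1`. [folklore] -/
theorem shear_mul_shearInv : (shear : Matrix (Fin 5) (Fin 5) R) * shearInv = 1 := by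
  ext i j; fin_cases i <;> fin_cases j <;>
    simp [shear, shearInv, Matrix.mul_apply, Fin.sum_univ_five]

/-- `shearInv · shear = 1`. [folklore] -/
theorem shearInv_mul_shear : (shearInv : Matrix (Fin 5) (Fin 5) R) * shear = 1 := by
  ext i j; fin_cases i <;> fin_cases j <;>
    simp [shear, shearInv, Matrix.mul_apply, Fin.sum_univ_five]

/-- **`J_Φ = J'_Φ · S`**: the column `∂_δ = (4I, 6J) = 2·(2I, 3J)` is twice the column `∂_u`
(Euler), so a unimodular shear separates the group block from the invariant block. [folklore] -/
theorem jacInv_eq_mul_shear (f w : BinaryQuartic R) : jacInv f w = jacInv' f w * shear := by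
  ext i j; fin_cases i <;> fin_cases j <;>
    simp [jacInv, jacInv', shear, Matrix.mul_apply, Fin.sum_univ_five] <;> ring

/-- `J'_Φ` acts blockwise: `J'_Φ z = (z₀, z₁, z₂, 2I z₃ + ∂I(w) z₄, 3J z₃ + ∂J(w) z₄)`. [folklore] -/
theorem jacInv'_mulVec (f w : BinaryQuartic R) (z : Fin 5 → R) :
    jacInv' f w *ᵥ z = ![z 0, z 1, z 2, 2 * f.I * z 3 + f.dIAt w * z 4, 3 * f.J * z 3 + f.dJAt w * z 4] := by
  funext i
  fin_cases i <;> simp [jacInv', Matrix.mulVec, dotProduct, Fin.sum_univ_five]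

/-- `S z = (z₀, z₁, z₂, 2 z₂ + z₃, z₄)`. [folklore] -/
theorem shear_mulVec (z : Fin 5 → R) :
    (shear : Matrix (Fin 5) (Fin 5) R) *ᵥ z = ![z 0, z 1, z 2, 2 * z 2 + z 3, z 4] := by
  funext i
  fin_cases i <;> simp [shear, Matrix.mulVec, dotProduct, Fin.sum_univ_five]

/-- `S⁻¹ z = (z₀, z₁, z₂, −2 z₂ + z₃, z₄)`. [folklore] -/
theorem shearInv_mulVec (z : Fin 5 → R) :
    (shearInv : Matrix (Fin 5) (Fin 5) R) *ᵥ z = ![z 0, z 1, z 2, -2 * z 2 + z 3, z 4] := by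
  funext i
  fin_cases i <;> simp [shearInv, Matrix.mulVec, dotProduct, Fin.sum_univ_five]

set_option maxHeartbeats 1000000 in
/-- **`det J_Φ = m(f, w)`** (block triangular). [folklore] -/
theorem det_jacInv (f w : BinaryQuartic R) : (jacInv f w).det = f.sliceJac w := by
  simp [jacInv, Matrix.det_succ_row_zero, Fin.sum_univ_succ, Matrix.submatrix, Fin.succAbove, sliceJac]
  ring

set_option maxHeartbeats 1000000 in
/-- `det J'_Φ = m(f, w)`. [folklore] -/
theorem det_jacInv' (f w : BinaryQuartic R) : (jacInv' f w).det = f.sliceJac w := by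
  simp [jacInv', Matrix.det_succ_row_zero, Fin.sum_univ_succ, Matrix.submatrix, Fin.succAbove, sliceJac]
  ring

set_option maxHeartbeats 1000000 in
/-- **`27 · det J_Ψ = m(f, w)`**: the Jacobian of the orbit chart is `1/27` times that of the
invariant chart — the source of the constant `|1/27|_p` (Bhargava–Shankar, Prop. 2.7: "follows
from a Jacobian computation", constant `2/27` for the basis `e, h, f`; here the torus direction is
`diag(1, δ)`, whose tangent is `(h + 1)/2` modulo scalars, whence `1/27`). [cite: BhargavaShankarAnnals2015, Prop. 2.7 (the constant 2/27; arXiv:1006.1002v2 numbering)] -/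
theorem det_jacOrbit (f w : BinaryQuartic R) : 27 * (jacOrbit f w).det = f.sliceJac w := by
  rw [sliceJac, dIAt_eq, dJAt_eq]
  simp [jacOrbit, Matrix.det_succ_row_zero, Fin.sum_univ_succ, Matrix.submatrix, Fin.succAbove, I, J]
  ring

/-! ## The Jacobians are the derivatives of the systems -/

/-- The slice form with explicit coefficients. [folklore] -/
theorem sliceForm_eq (f w : BinaryQuartic R) :
    sliceForm f w = ⟨(1 + X 3) * C f.a + X 4 * C w.a, (1 + X 3) * C f.b + X 4 * C w.b,
        (1 + X 3) * C f.c + X 4 * C w.c, (1 + X 3) * C f.d + X 4 * C w.d, (1 + X 3) * C f.e + X 4 * C w.e⟩ := by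
  unfold sliceForm
  apply BinaryQuartic.ext <;> simp [BinaryQuartic.map]

set_option maxRecDepth 4000 in
/-- Component `0` of the orbit chart as an explicit polynomial (the formula `BinaryQuartic.subst`
with `p = 1`, `q = β`, `r = γ`, `s = δ + βγ` and `g = (1+u)f + vw`). [folklore] -/
theorem orbitChart_apply_zero (f w : BinaryQuartic R) :
    orbitChart f w 0 =
      ((1 + X 3) * C f.a + X 4 * C w.a) + ((1 + X 3) * C f.b + X 4 * C w.b) * X 0 + ((1 + X 3) * C f.c + X 4 * C w.c) * X 0 ^ 2 + ((1 + X 3) * C f.d + X 4 * C w.d) * X 0 ^ 3 + ((1 + X 3) * C f.e + X 4 * C w.e) * X 0 ^ 4 := by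
  have hs := sliceForm_eq f w
  unfold orbitChart chartMatrix
  rw [hs]
  simp only [coeffs, subst, Matrix.of_apply, Matrix.cons_val', Matrix.cons_val_zero, Matrix.cons_val_one,
    Matrix.empty_val', Matrix.cons_val_fin_one, one_pow, mul_one]

set_option maxRecDepth 4000 in
/-- Component `1` of the orbit chart as an explicit polynomial (the formula `BinaryQuartic.subst`
with `p = 1`, `q = β`, `r = γ`, `s = δ + βγ` and `g = (1+u)f + vw`). [folklore] -/
theorem orbitChart_apply_one (f w : BinaryQuartic R) :
    orbitChart f w 1 =
      4 * ((1 + X 3) * C f.a + X 4 * C w.a) * X 1 + ((1 + X 3) * C f.b + X 4 * C w.b) * (X 2 + X 0 * X 1) + 3 * ((1 + X 3) * C f.b + X 4 * C w.b) * X 0 * X 1 + 2 * ((1 + X 3) * C f.c + X 4 * C w.c) * X 0 * (X 2 + X 0 * X 1)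
      + 2 * ((1 + X 3) * C f.c + X 4 * C w.c) * X 0 ^ 2 * X 1 + 3 * ((1 + X 3) * C f.d + X 4 * C w.d) * X 0 ^ 2 * (X 2 + X 0 * X 1) + ((1 + X 3) * C f.d + X 4 * C w.d) * X 0 ^ 3 * X 1
      + 4 * ((1 + X 3) * C f.e + X 4 * C w.e) * X 0 ^ 3 * (X 2 + X 0 * X 1) := by
  have hs := sliceForm_eq f w
  unfold orbitChart chartMatrix
  rw [hs]
  simp only [coeffs, subst, Matrix.of_apply, Matrix.cons_val', Matrix.cons_val_zero, Matrix.cons_val_one,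
    Matrix.empty_val', Matrix.cons_val_fin_one, one_pow, mul_one]

set_option maxRecDepth 4000 in
/-- Component `2` of the orbit chart as an explicit polynomial (the formula `BinaryQuartic.subst`
with `p = 1`, `q = β`, `r = γ`, `s = δ + βγ` and `g = (1+u)f + vw`). [folklore] -/
theorem orbitChart_apply_two (f w : BinaryQuartic R) :
    orbitChart f w 2 =
      6 * ((1 + X 3) * C f.a + X 4 * C w.a) * X 1 ^ 2 + 3 * ((1 + X 3) * C f.b + X 4 * C w.b) * X 1 * (X 2 + X 0 * X 1) + 3 * ((1 + X 3) * C f.b + X 4 * C w.b) * X 0 * X 1 ^ 2 + ((1 + X 3) * C f.c + X 4 * C w.c) * (X 2 + X 0 * X 1) ^ 2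
      + 4 * ((1 + X 3) * C f.c + X 4 * C w.c) * X 0 * X 1 * (X 2 + X 0 * X 1) + ((1 + X 3) * C f.c + X 4 * C w.c) * X 0 ^ 2 * X 1 ^ 2 + 3 * ((1 + X 3) * C f.d + X 4 * C w.d) * X 0 * (X 2 + X 0 * X 1) ^ 2
      + 3 * ((1 + X 3) * C f.d + X 4 * C w.d) * X 0 ^ 2 * X 1 * (X 2 + X 0 * X 1) + 6 * ((1 + X 3) * C f.e + X 4 * C w.e) * X 0 ^ 2 * (X 2 + X 0 * X 1) ^ 2 := by
  have hs := sliceForm_eq f w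
  unfold orbitChart chartMatrix
  rw [hs]
  simp only [coeffs, subst, Matrix.of_apply, Matrix.cons_val', Matrix.cons_val_zero, Matrix.cons_val_one,
    Matrix.empty_val', Matrix.cons_val_fin_one, Matrix.cons_val_two, Matrix.head_cons, Matrix.tail_cons, one_pow, mul_one]

set_option maxRecDepth 4000 in
/-- Component `3` of the orbit chart as an explicit polynomial (the formula `BinaryQuartic.subst`
with `p = 1`, `q = β`, `r = γ`, `s = δ + βγ` and `g = (1+u)f + vw`). [folklore] -/
theorem orbitChart_apply_three (f w : BinaryQuartic R) :
    orbitChart f w 3 =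
      4 * ((1 + X 3) * C f.a + X 4 * C w.a) * X 1 ^ 3 + 3 * ((1 + X 3) * C f.b + X 4 * C w.b) * X 1 ^ 2 * (X 2 + X 0 * X 1) + ((1 + X 3) * C f.b + X 4 * C w.b) * X 0 * X 1 ^ 3 + 2 * ((1 + X 3) * C f.c + X 4 * C w.c) * X 1 * (X 2 + X 0 * X 1) ^ 2
      + 2 * ((1 + X 3) * C f.c + X 4 * C w.c) * X 0 * X 1 ^ 2 * (X 2 + X 0 * X 1) + ((1 + X 3) * C f.d + X 4 * C w.d) * (X 2 + X 0 * X 1) ^ 3 + 3 * ((1 + X 3) * C f.d + X 4 * C w.d) * X 0 * X 1 * (X 2 + X 0 * X 1) ^ 2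
      + 4 * ((1 + X 3) * C f.e + X 4 * C w.e) * X 0 * (X 2 + X 0 * X 1) ^ 3 := by
  have hs := sliceForm_eq f w
  unfold orbitChart chartMatrix
  rw [hs]
  simp only [coeffs, subst, Matrix.of_apply, Matrix.cons_val', Matrix.cons_val_zero, Matrix.cons_val_one,
    Matrix.empty_val', Matrix.cons_val_fin_one, Matrix.cons_val_three, Matrix.head_cons, Matrix.tail_cons, one_pow, mul_one]

set_option maxRecDepth 4000 in
/-- Component `4` of the orbit chart as an explicit polynomial (the formula `BinaryQuartic.subst`
with `p = 1`, `q = β`, `r = γ`, `s = δ + βγ` and `g = (1+u)f + vw`). [folklore] -/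
theorem orbitChart_apply_four (f w : BinaryQuartic R) :
    orbitChart f w 4 =
      ((1 + X 3) * C f.a + X 4 * C w.a) * X 1 ^ 4 + ((1 + X 3) * C f.b + X 4 * C w.b) * X 1 ^ 3 * (X 2 + X 0 * X 1) + ((1 + X 3) * C f.c + X 4 * C w.c) * X 1 ^ 2 * (X 2 + X 0 * X 1) ^ 2 + ((1 + X 3) * C f.d + X 4 * C w.d) * X 1 * (X 2 + X 0 * X 1) ^ 3
      + ((1 + X 3) * C f.e + X 4 * C w.e) * (X 2 + X 0 * X 1) ^ 4 := by
  have hs := sliceForm_eq f w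
  unfold orbitChart chartMatrix
  rw [hs]
  simp only [coeffs, subst, Matrix.of_apply, Matrix.cons_val', Matrix.cons_val_zero, Matrix.cons_val_one,
    Matrix.empty_val', Matrix.cons_val_fin_one, Matrix.cons_val_four, Matrix.head_cons, Matrix.tail_cons, one_pow, mul_one]

set_option maxHeartbeats 1000000 in
/-- **The Jacobian of the orbit chart at the base point is `jacOrbit f w`.** [folklore] -/
theorem jacobian_orbitChart (f w : BinaryQuartic R) :
    (Matrix.of fun i j ↦ MvPolynomial.eval chartCenter (pderiv j (orbitChart f w i))) = jacOrbit f w := by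
  ext i j
  fin_cases i <;> fin_cases j <;>
    simp [orbitChart_apply_zero, orbitChart_apply_one, orbitChart_apply_two, orbitChart_apply_three,
      orbitChart_apply_four, jacOrbit, chartCenter, Derivation.leibniz, Derivation.leibniz_pow, pderiv_X, mul_comm]

/-- `I` of the slice form: `(1+u)² I(f) + (1+u) v ∂I_f(w) + v² I(w)`. [folklore] -/
theorem I_sliceForm (f w : BinaryQuartic R) :
    (sliceForm f w).I = (1 + X 3) ^ 2 * C f.I + (1 + X 3) * X 4 * C (f.dIAt w) + X 4 ^ 2 * C w.I := by
  unfold sliceForm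
  rw [I_add_smul_dIAt, I_smul, I_map, I_map, dIAt_smul_left, dIAt_map]
  ring

/-- `J` of the slice form: `(1+u)³ J(f) + (1+u)² v ∂J_f(w) + v² · Q`. [folklore] -/
theorem J_sliceForm_exists (f w : BinaryQuartic R) :
    ∃ Q : MvPolynomial (Fin 5) R,
      (sliceForm f w).J = (1 + X 3) ^ 3 * C f.J + (1 + X 3) ^ 2 * X 4 * C (f.dJAt w) + X 4 ^ 2 * Q := by
  unfold sliceForm
  obtain ⟨Q, hQ⟩ := J_add_smul_exists ((1 + X 3 : MvPolynomial (Fin 5) R) • f.map (C : R →+* MvPolynomial (Fin 5) R))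
    (w.map (C : R →+* MvPolynomial (Fin 5) R)) (X 4)
  refine ⟨Q, ?_⟩
  rw [hQ, J_smul, J_map, dJAt_smul_left, dJAt_map]
  ring

set_option maxHeartbeats 1000000 in
/-- **The Jacobian of the invariant chart at the base point is `jacInv f w`.** [folklore] -/
theorem jacobian_invChart (f w : BinaryQuartic R) :
    (Matrix.of fun i j ↦ MvPolynomial.eval chartCenter (pderiv j (invChart f w i))) = jacInv f w := by
  obtain ⟨Q, hQ⟩ := J_sliceForm_exists f w
  have hI := I_sliceForm f w
  unfold invChart
  ext i j
  fin_cases i <;> fin_cases j <;>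
    simp [hI, hQ, jacInv, chartCenter, Derivation.leibniz, Derivation.leibniz_pow, pderiv_X, mul_comm]

/-! ## Nondegeneracy: some coordinate direction is transverse -/

/-- `∂I_f(e_κ) = ∂_κ I(f)` and `∂J_f(e_κ) = ∂_κ J(f)`. [folklore] -/
theorem dIAt_unitForm (f : BinaryQuartic R) (κ : Fin 5) : f.dIAt (unitForm κ) = f.gradI κ := by
  simp [dIAt, coeffs_unitForm, Pi.single_apply, Finset.sum_ite_eq']

/-- `∂J_f(e_κ) = ∂_κ J(f)`. [folklore] -/
theorem dJAt_unitForm (f : BinaryQuartic R) (κ : Fin 5) : f.dJAt (unitForm κ) = f.gradJ κ := by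
  simp [dJAt, coeffs_unitForm, Pi.single_apply, Finset.sum_ite_eq']

/-- The `2 × 2` minors of `(∂I; ∂J)` in terms of the slice Jacobians: `2I · (∂_κI ∂_λJ − ∂_λI ∂_κJ)
= ∂_κI · m(f,e_λ) − ∂_λI · m(f,e_κ)`. [folklore] -/
theorem two_I_mul_minor (f : BinaryQuartic R) (κ μ : Fin 5) :
    2 * f.I * (f.gradI κ * f.gradJ μ - f.gradI μ * f.gradJ κ) =
      f.gradI κ * f.sliceJac (unitForm μ) - f.gradI μ * f.sliceJac (unitForm κ) := by
  simp only [sliceJac, dIAt_unitForm, dJAt_unitForm]; ring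

/-- `3J · (∂_κI ∂_λJ − ∂_λI ∂_κJ) = ∂_κJ · m(f,e_λ) − ∂_λJ · m(f,e_κ)`. [folklore] -/
theorem three_J_mul_minor (f : BinaryQuartic R) (κ μ : Fin 5) :
    3 * f.J * (f.gradI κ * f.gradJ μ - f.gradI μ * f.gradJ κ) =
      f.gradJ κ * f.sliceJac (unitForm μ) - f.gradJ μ * f.sliceJac (unitForm κ) := by
  simp only [sliceJac, dIAt_unitForm, dJAt_unitForm]; ring

/-- **Nondegeneracy.** Over a field with `2 ≠ 0`, `3 ≠ 0`: if `Δ(f) ≠ 0` then `m(f, e_κ) ≠ 0` for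
some coordinate form `e_κ` — otherwise `2I ∂J = 3J ∂I` and, `(I, J) ≠ (0,0)`, all `2 × 2` minors of
`(∂I; ∂J)` vanish, contradicting `jacobianMinor_ne_zero_of_disc_ne_zero`. [folklore] -/
theorem exists_sliceJac_unitForm_ne_zero {K : Type*} [Field K] (h2 : (2 : K) ≠ 0) (h3 : (3 : K) ≠ 0)
    {f : BinaryQuartic K} (hΔ : f.disc ≠ 0) : ∃ κ : Fin 5, f.sliceJac (unitForm κ) ≠ 0 := by
  by_contra hall
  rw [not_exists] at hall
  simp only [not_not] at hall
  -- all minors vanish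
  have hminor : ∀ κ μ : Fin 5, f.gradI κ * f.gradJ μ - f.gradI μ * f.gradJ κ = 0 := by
    intro κ μ
    by_cases hI : f.I = 0
    · -- then `J ≠ 0`
      have hJ : f.J ≠ 0 := by
        intro hJ
        apply hΔ
        have h27 := twentySeven_mul_disc f
        rw [hI, hJ] at h27
        have : (27 : K) * f.disc = 0 := by rw [h27]; ring
        exact (mul_eq_zero.mp this).resolve_left (by
          have : (27 : K) = 3 * 3 * 3 := by norm_num
          rw [this]; exact mul_ne_zero (mul_ne_zero h3 h3) h3)
      have h := three_J_mul_minor f κ μ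
      rw [hall κ, hall μ, mul_zero, mul_zero, sub_zero] at h
      exact (mul_eq_zero.mp h).resolve_left (mul_ne_zero h3 hJ)
    · have h := two_I_mul_minor f κ μ
      rw [hall κ, hall μ, mul_zero, mul_zero, sub_zero] at h
      exact (mul_eq_zero.mp h).resolve_left (mul_ne_zero h2 hI)
  have hmin := jacobianMinor_ne_zero_of_disc_ne_zero h2 h3 hΔ
  have e01 := hminor 0 1
  have e02 := hminor 0 2
  have e03 := hminor 0 3
  simp only [gradI, gradJ, Matrix.cons_val_zero, Matrix.cons_val_one, Matrix.head_cons,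
    Matrix.cons_val_two, Matrix.tail_cons, Matrix.cons_val_three] at e01 e02 e03
  rcases hmin with h | h | h
  · exact h (by linear_combination e01)
  · exact h (by linear_combination e02)
  · exact h (by linear_combination e03)

end BinaryQuartic

end Literature.NumberTheory.EllipticCurves

end
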